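import Mathlib
import HarnessLib

/-!
# «BIG-O BUDGET SHARPNESS» for crux ⟨stmt-QuantumFields-23035⟩ `ShortRootRigidity` — the witness and its elementary clauses

Free-hands work of width seat `ym-line-sfw-p2-w3` (g37, cell `ym-idea-1`) on the owner's NEGATIVE TARGET
`Cruxes/ShortRootRigidity/BigOBudgetSharpnessTarget.lean` (ym-idea-3 g21, crux-write f5448735ed23; critic idea-crit-4 endorsement):
the `W(F₄)`-invariant harmonic sextic in LATTICE FORM `3h₆(x) = 15‖x‖⁶ − Σ_{v = ±eᵢ±eⱼ} ⟪v,x⟫⁶` and the witness `K = 3h₆/‖x‖¹⁴`, with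
the definitions and the clause Props restated CHARACTER-FOR-CHARACTER (same namespace), and the ELEMENTARY clauses proved:

* `rootSextic_expand` — `Σ_v ⟪v,x⟫⁶ = 12Σxᵢ⁶ + 60Σ_{i≠j}xᵢ⁴xⱼ²`, hence `0 ≤ Σ_v⟪v,x⟫⁶ ≤ 20‖x‖⁶` and `|3h₆(x)| ≤ 15‖x‖⁶`;
* `witnessBigO : WitnessBigO` (`‖x‖⁸|K x| ≤ 15`), `witnessBoundedOutsideBall : WitnessBoundedOutsideBall`,
  `witnessContinuousOffZero : WitnessContinuousOffZero`;
* `witnessNotRadial : WitnessNotRadial` — the Householder reflection taking `(1,1,0,0)` to the RATIONAL point `(7/5,1/5,0,0)` of the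
  same norm: `3h₆ = −24 < 0` at the root direction, `3h₆ = 316200/15625 > 0` at the other (no `√2` needed).

NOT in this file: the symmetry clauses (`WitnessSignedPermInvariant`, `WitnessLatticeInvariant` — «R permutes the 24 minimal vectors») and
the reflection-positivity clause (Laplace–Fourier representation) — separate files.  HONEST LABEL: sharpness bookkeeping about the HYPOTHESES
of an OPEN crux; nothing of ⟨23035⟩, R2d or the Yang–Mills mass gap is proved by this.
-/

set_option autoImplicit false

noncomputable section

namespace Summit.QuantumFields.YangMills.Cruxes.ShortRootRigidity.Sharpness

open scoped Topology BigOperators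
open Filter Set

/-! ## The registered texts (verbatim from the target file) -/

/-- `ℝ⁴`. -/
abbrev E4 := EuclideanSpace ℝ (Fin 4)

/-- The coordinate vector `eᵢ`. [problem-side definition] -/
def e (i : Fin 4) : E4 := EuclideanSpace.single i (1 : ℝ)

/-- The 24 minimal vectors `±eᵢ ± eⱼ` (`i < j`) of the checkerboard lattice `D₄`, listed with signs `(σ, τ) ∈ {±1}²` as a function on
`Fin 4 × Fin 4 × Bool × Bool` restricted to `i < j` inside the sum below. [problem-side definition] -/
def rootVec (i j : Fin 4) (a b : Bool) : E4 :=
  (if a then (1 : ℝ) else -1) • e i + (if b then (1 : ℝ) else -1) • e j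

/-- The lattice sextic `Σ_{v ∈ D₄, ‖v‖² = 2} ⟪v, x⟫⁶` (sum over `i < j` and the four sign choices). [problem-side definition] -/
def rootSextic (x : E4) : ℝ :=
  ∑ i : Fin 4, ∑ j : Fin 4, if i < j then
    (inner ℝ (rootVec i j true true) x) ^ 6 + (inner ℝ (rootVec i j true false) x) ^ 6 +
    (inner ℝ (rootVec i j false true) x) ^ 6 + (inner ℝ (rootVec i j false false) x) ^ 6
  else 0

/-- `3·h₆(x) = 15‖x‖⁶ − Σ_v ⟪v,x⟫⁶`, the W(F₄)-invariant harmonic sextic in lattice form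
(`h₆ = Σxᵢ⁶ − 5Σ_{i≠j}xᵢ⁴xⱼ² + 30Σ_{i<j<k}xᵢ²xⱼ²xₖ²`). [problem-side definition] -/
def h6three (x : E4) : ℝ := 15 * ‖x‖ ^ 6 - rootSextic x

/-- THE WITNESS `K(x) = 3h₆(x)/‖x‖¹⁴` (value `0` at `x = 0`). [problem-side definition] -/
def bigOWitness (x : E4) : ℝ := h6three x / ‖x‖ ^ 14

/-- Witness clause: continuity off `0` (verbatim). [problem-side target] -/
def WitnessContinuousOffZero : Prop := ContinuousOn bigOWitness {x | x ≠ 0}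

/-- Witness clause: boundedness outside the unit ball (verbatim). [problem-side target] -/
def WitnessBoundedOutsideBall : Prop := ∃ C : ℝ, ∀ x, 1 ≤ ‖x‖ → |bigOWitness x| ≤ C

/-- Witness clause: the big-O sub-curvature budget (verbatim). [problem-side target] -/
def WitnessBigO : Prop := ∃ C : ℝ, ∀ x, x ≠ 0 → ‖x‖ ^ 8 * |bigOWitness x| ≤ C

/-- Witness clause: NOT `O(4)`-invariant (verbatim). [problem-side target] -/
def WitnessNotRadial : Prop := ∃ (R : E4 ≃ₗᵢ[ℝ] E4) (x : E4), bigOWitness (R x) ≠ bigOWitness x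

/-! ## The lattice sextic in coordinates -/

/-- `⟪±eᵢ ± eⱼ, x⟫ = ±xᵢ ± xⱼ`. -/
theorem inner_rootVec (i j : Fin 4) (a b : Bool) (x : E4) :
    inner ℝ (rootVec i j a b) x = (if a then (1 : ℝ) else -1) * x i + (if b then (1 : ℝ) else -1) * x j := by
  cases a <;> cases b <;> simp [rootVec, e, inner_add_left, inner_neg_left, EuclideanSpace.inner_single_left]

/-- **Closed form** `Σ_v ⟪v,x⟫⁶ = 12Σxᵢ⁶ + 60Σ_{i≠j}xᵢ⁴xⱼ²`. -/
theorem rootSextic_expand (x : E4) :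
    rootSextic x = 12 * (x 0 ^ 6 + x 1 ^ 6 + x 2 ^ 6 + x 3 ^ 6) +
      60 * (x 0 ^ 4 * x 1 ^ 2 + x 0 ^ 2 * x 1 ^ 4 + x 0 ^ 4 * x 2 ^ 2 + x 0 ^ 2 * x 2 ^ 4 +
        x 0 ^ 4 * x 3 ^ 2 + x 0 ^ 2 * x 3 ^ 4 + x 1 ^ 4 * x 2 ^ 2 + x 1 ^ 2 * x 2 ^ 4 +
        x 1 ^ 4 * x 3 ^ 2 + x 1 ^ 2 * x 3 ^ 4 + x 2 ^ 4 * x 3 ^ 2 + x 2 ^ 2 * x 3 ^ 4) := by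
  simp only [rootSextic, inner_rootVec, Fin.sum_univ_four, Fin.isValue, Fin.reduceLT, if_true, if_false,
    Bool.false_eq_true]
  ring

/-- `‖x‖² = Σ xᵢ²` on `ℝ⁴`. -/
theorem norm_sq_E4 (x : E4) : ‖x‖ ^ 2 = x 0 ^ 2 + x 1 ^ 2 + x 2 ^ 2 + x 3 ^ 2 := by
  rw [EuclideanSpace.real_norm_sq_eq, Fin.sum_univ_four]

/-- `3h₆` in coordinates. -/
theorem h6three_expand (x : E4) :
    h6three x = 15 * (x 0 ^ 2 + x 1 ^ 2 + x 2 ^ 2 + x 3 ^ 2) ^ 3 - rootSextic x := by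
  rw [h6three, show ‖x‖ ^ 6 = (‖x‖ ^ 2) ^ 3 by ring, norm_sq_E4]

/-- `0 ≤ Σ_v ⟪v,x⟫⁶`. -/
theorem rootSextic_nonneg (x : E4) : 0 ≤ rootSextic x := by
  rw [rootSextic_expand]; positivity

/-- `Σ_v ⟪v,x⟫⁶ ≤ 20‖x‖⁶` (`20(Σa)³ − (12Σa³ + 60Σ_{i≠j}a²b) = 8Σa³ + 120Σabc ≥ 0`, `a = xᵢ²`). -/
theorem rootSextic_le (x : E4) : rootSextic x ≤ 20 * ‖x‖ ^ 6 := by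
  rw [rootSextic_expand, show ‖x‖ ^ 6 = (‖x‖ ^ 2) ^ 3 by ring, norm_sq_E4]
  have h0 := sq_nonneg (x 0)
  have h1 := sq_nonneg (x 1)
  have h2 := sq_nonneg (x 2)
  have h3 := sq_nonneg (x 3)
  have key : 20 * (x 0 ^ 2 + x 1 ^ 2 + x 2 ^ 2 + x 3 ^ 2) ^ 3 -
      (12 * (x 0 ^ 6 + x 1 ^ 6 + x 2 ^ 6 + x 3 ^ 6) +
        60 * (x 0 ^ 4 * x 1 ^ 2 + x 0 ^ 2 * x 1 ^ 4 + x 0 ^ 4 * x 2 ^ 2 + x 0 ^ 2 * x 2 ^ 4 +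
          x 0 ^ 4 * x 3 ^ 2 + x 0 ^ 2 * x 3 ^ 4 + x 1 ^ 4 * x 2 ^ 2 + x 1 ^ 2 * x 2 ^ 4 +
          x 1 ^ 4 * x 3 ^ 2 + x 1 ^ 2 * x 3 ^ 4 + x 2 ^ 4 * x 3 ^ 2 + x 2 ^ 2 * x 3 ^ 4)) =
      8 * ((x 0 ^ 2) ^ 3 + (x 1 ^ 2) ^ 3 + (x 2 ^ 2) ^ 3 + (x 3 ^ 2) ^ 3) +
        120 * (x 0 ^ 2 * x 1 ^ 2 * x 2 ^ 2 + x 0 ^ 2 * x 1 ^ 2 * x 3 ^ 2 + x 0 ^ 2 * x 2 ^ 2 * x 3 ^ 2 +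
          x 1 ^ 2 * x 2 ^ 2 * x 3 ^ 2) := by ring
  have hpos : 0 ≤ 8 * ((x 0 ^ 2) ^ 3 + (x 1 ^ 2) ^ 3 + (x 2 ^ 2) ^ 3 + (x 3 ^ 2) ^ 3) +
      120 * (x 0 ^ 2 * x 1 ^ 2 * x 2 ^ 2 + x 0 ^ 2 * x 1 ^ 2 * x 3 ^ 2 + x 0 ^ 2 * x 2 ^ 2 * x 3 ^ 2 +
        x 1 ^ 2 * x 2 ^ 2 * x 3 ^ 2) := by positivity
  linarith

/-- `|3h₆(x)| ≤ 15‖x‖⁶`. -/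
theorem abs_h6three_le (x : E4) : |h6three x| ≤ 15 * ‖x‖ ^ 6 := by
  rw [h6three, abs_le]
  have h1 := rootSextic_nonneg x
  have h2 := rootSextic_le x
  have h3 : 0 ≤ ‖x‖ ^ 6 := by positivity
  constructor <;> linarith

/-! ## The elementary clauses -/

/-- **Big-O budget**: `‖x‖⁸ |K(x)| ≤ 15` off `0`. -/
theorem witnessBigO : WitnessBigO := by
  refine ⟨15, fun x hx => ?_⟩
  have hn : 0 < ‖x‖ := norm_pos_iff.2 hx
  rw [bigOWitness, abs_div, abs_of_pos (pow_pos hn 14)]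
  have h := abs_h6three_le x
  rw [show ‖x‖ ^ 8 * (|h6three x| / ‖x‖ ^ 14) = |h6three x| / ‖x‖ ^ 6 by field_simp, div_le_iff₀ (pow_pos hn 6)]
  exact h

/-- **Boundedness outside the unit ball**: `|K(x)| ≤ 15` for `‖x‖ ≥ 1`. -/
theorem witnessBoundedOutsideBall : WitnessBoundedOutsideBall := by
  refine ⟨15, fun x hx => ?_⟩
  have hn : 0 < ‖x‖ := lt_of_lt_of_le one_pos hx
  rw [bigOWitness, abs_div, abs_of_pos (pow_pos hn 14), div_le_iff₀ (pow_pos hn 14)]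
  have h := abs_h6three_le x
  have h14 : ‖x‖ ^ 6 ≤ ‖x‖ ^ 14 := pow_le_pow_right₀ hx (by norm_num)
  linarith

/-- The coordinates are continuous on `ℝ⁴`. -/
theorem continuous_coord (i : Fin 4) : Continuous fun x : E4 => x i :=
  (continuous_apply i).comp (PiLp.continuous_ofLp 2 _)

/-- `3h₆` is continuous. -/
theorem continuous_h6three : Continuous h6three := by
  have h : h6three = fun x : E4 => 15 * (x 0 ^ 2 + x 1 ^ 2 + x 2 ^ 2 + x 3 ^ 2) ^ 3 -
      (12 * (x 0 ^ 6 + x 1 ^ 6 + x 2 ^ 6 + x 3 ^ 6) +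
        60 * (x 0 ^ 4 * x 1 ^ 2 + x 0 ^ 2 * x 1 ^ 4 + x 0 ^ 4 * x 2 ^ 2 + x 0 ^ 2 * x 2 ^ 4 +
          x 0 ^ 4 * x 3 ^ 2 + x 0 ^ 2 * x 3 ^ 4 + x 1 ^ 4 * x 2 ^ 2 + x 1 ^ 2 * x 2 ^ 4 +
          x 1 ^ 4 * x 3 ^ 2 + x 1 ^ 2 * x 3 ^ 4 + x 2 ^ 4 * x 3 ^ 2 + x 2 ^ 2 * x 3 ^ 4)) := by
    funext x; rw [h6three_expand, rootSextic_expand]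
  rw [h]
  have h0 := continuous_coord 0
  have h1 := continuous_coord 1
  have h2 := continuous_coord 2
  have h3 := continuous_coord 3
  fun_prop

/-- **Continuity off the origin.** -/
theorem witnessContinuousOffZero : WitnessContinuousOffZero := by
  refine ContinuousOn.div continuous_h6three.continuousOn (by fun_prop) fun x hx => ?_
  exact pow_ne_zero 14 (norm_ne_zero_iff.2 hx)

/-! ## Not radial -/

/-- The root direction `(1,1,0,0)`. -/
def vRoot : E4 := (WithLp.equiv 2 (Fin 4 → ℝ)).symm ![1, 1, 0, 0]

/-- The rational point `(7/5, 1/5, 0, 0)` of the same norm. -/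
def vRat : E4 := (WithLp.equiv 2 (Fin 4 → ℝ)).symm ![7 / 5, 1 / 5, 0, 0]

/-- `3h₆(1,1,0,0) = −24`. -/
theorem h6three_vRoot : h6three vRoot = -24 := by
  rw [h6three_expand, rootSextic_expand, vRoot]
  simp
  norm_num

/-- `3h₆(7/5,1/5,0,0) = 316200/15625`. -/
theorem h6three_vRat : h6three vRat = 316200 / 15625 := by
  rw [h6three_expand, rootSextic_expand, vRat]
  simp
  norm_num

/-- `‖(1,1,0,0)‖² = 2`. -/
theorem norm_sq_vRoot : ‖vRoot‖ ^ 2 = 2 := by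
  rw [norm_sq_E4, vRoot]; simp; norm_num

/-- `‖(7/5,1/5,0,0)‖² = 2`. -/
theorem norm_sq_vRat : ‖vRat‖ ^ 2 = 2 := by
  rw [norm_sq_E4, vRat]; simp; norm_num

/-- The two points have the same norm. -/
theorem norm_vRoot_eq : ‖vRoot‖ = ‖vRat‖ := by
  have h1 := norm_sq_vRoot
  have h2 := norm_sq_vRat
  nlinarith [norm_nonneg vRoot, norm_nonneg vRat]

/-- **The witness is not `O(4)`-invariant**: the Householder reflection taking `(1,1,0,0)` to `(7/5,1/5,0,0)` changes the sign
of `K`. -/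
theorem witnessNotRadial : WitnessNotRadial := by
  refine ⟨Submodule.reflection (ℝ ∙ (vRoot - vRat))ᗮ, vRoot, ?_⟩
  rw [Submodule.reflection_sub norm_vRoot_eq, bigOWitness, bigOWitness, norm_vRoot_eq, h6three_vRoot, h6three_vRat]
  have hpos : 0 < ‖vRat‖ ^ 14 := by
    have h2 := norm_sq_vRat
    have : 0 < ‖vRat‖ := by nlinarith [norm_nonneg vRat]
    positivity
  intro h
  rw [div_eq_div_iff hpos.ne' hpos.ne'] at h
  nlinarith

end Summit.QuantumFields.YangMills.Cruxes.ShortRootRigidity.Sharpness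

end
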